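import Summits.BirchSwinnertonDyer.BirchSwinnertonDyer.Theorems.EisensteinPrimesResidualIndexUnramified
import Summits.BirchSwinnertonDyer.BirchSwinnertonDyer.Theorems.EisensteinPrimesResidualDevissageCount
import Summits.BirchSwinnertonDyer.BirchSwinnertonDyer.Theorems.EisensteinPrimesResidualIndexKummer
import Summits.BirchSwinnertonDyer.BirchSwinnertonDyer.Theorems.EisensteinPrimesLambdaIdentityOfIndexInputs
import HarnessLib

/-!
# The index data of ONE module (`loc`, the Kummer maps `κ`, `κ'`) and the residual rows on the unramified classes —
# the per-module packages feeding the MID-LEVEL COMPOSITION of the V21 index road (companion file `…ResidualIndexAssembly`)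
# (cell `bsd-eis`, seat `bsd-line-x1-p1` LEAD g4; crux 2 `GoodLatticeBDPValue` stmt-BirchSwinnertonDyer-19032, line `halves`)

HONEST FRAMING (cell `bsd-eis`, run/shared/lean/pub/bsd-eis/): Galois-cohomology bookkeeping (no definition, no named fact,
no `sorry`, no `Theses` import); nothing about any curve is asserted; BSD / IMC2 / KY Thm. 1.4.1 are proved for NO curve.
Helper `--supports stmt-BirchSwinnertonDyer-19032`; closes no registered stub.

## What (this file = §1–§3; the composition `zpCorank_datumStrictSelmer_add_eq` is in `…ResidualIndexAssembly`)

`exists_module_index_data` (one module: signature map `loc`, Kummer surjections `κ : U(N) ↠ U(A)[p]`, `κ'`, their formulas,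
SUR/DIV/COT transfers, `ker loc ≅ R(A)`), `exists_rows_data` (the residual row `U(N₁) → U(N₂) → U(N₃)`: exact, `#ker = #N₃^H`,
image), `mem_datumStrictSelmer_iff_of_reps`, `natCard_ker_compLeft`. The consumer: for `H ≤ Γ_K` normal (`Gal(K̄/K_∞)`), a prime `𝔭 ∋ p`, a set `S₀` of places, `p^c` elements
`τ i` whose conjugates exhaust the places of `K_∞` above `𝔭` (hypotheses `hreps`, Brink / x2-p2), a residual exact sequence
`0 → N₁ →i N₂ →π N₃ → 0` and Kummer embeddings `j_k : N_k ↪ A_k` onto `A_k[p]` of `p`-divisible discrete `Γ_K`-modules: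
GIVEN (SUR) the signature maps `U(A_k) → ∏_{i<p^c} H¹(H ⊓ D_𝔭, A_k)` are onto (`U` = unramified outside `S₀ ∪ {p}`), (DIV)
`H¹(H ⊓ D_𝔭, A_k)` is `p`-divisible, (LRS) `π_*` is onto on `H¹(H ⊓ D_𝔭, ·)`, (U) injectivity of `i_*, j_{k*}` on the inertia
cohomology at good places, (COT) the strict groups `R(A_k) := datumStrictSelmer H A_k p (bdpData A_k p 𝔭) S₀` are `p`-primary with
finite `p`-torsion, (H⁰) `A_k^H` `p`-divisible in invariants, `N₂^H = 0`, `#N₃^H = p^ε`, `N₁^{H⊓D_𝔭} = 0`, `H ⊓ D_𝔭` trivial on `N₃`,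
`#N₃ = p`, `A₂^{H⊓D_𝔭}` finite, `A₁^{H⊓D_𝔭}, A₃^{H⊓D_𝔭}` divisible in invariants, and (H²) the bookkeeping identity
`#(U(N₃)/π_*U(N₂)) · #(U(A₂)/p) = #(U(A₁)/p) · #(U(A₃)/p)` — THEN
**`zpCorank R(A₂) + ε = zpCorank R(A₁) + zpCorank R(A₃) + p^c`.**
Proof: the abstract identity `FiniteIndexCalculus.zpCorank_add_eq_of_index_inputs` (p643231) at the data built from files
`…ResidualIndexUnramified` (p644391), `…ResidualIndexKummer` (p643894). At `A₂ = E[p^∞]`, `A₁ = (F/𝒪)(ω̃)`, `A₃ = (F/𝒪)(𝟙̃)` over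
the anticyclotomic `K_∞` with `𝔭 = v̄` this is step (7) of the road: `λ_str(f) + ε = λ_str(ω̃) + λ_str(𝟙̃) + s`.

References: [KellerYin2024] Thm. 1.4.1, §1.4 (arXiv:2402.12781v2 TeX L1087–1330); the road memo
`Cruxes/GoodLatticeBDPValue/Lines/halves-imprimLambda-index-road.md`; [SerreGaloisCohomology1997] I §2.
-/

set_option autoImplicit false
set_option linter.dupNamespace false -- the summit namespace `…BirchSwinnertonDyer.BirchSwinnertonDyer.Theorems` (Sub = Summit, D-0017) trips it

noncomputable section

open scoped Classical AddSubgroup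

namespace Summit.BirchSwinnertonDyer.BirchSwinnertonDyer.Theorems.ResidualIndexModuleData

open Function NumberField IsDedekindDomain Field
open Literature.NumberTheory.EllipticCurves Literature.NumberTheory.EllipticCurves.GreenbergSelmer
  Literature.NumberTheory.EllipticCurves.GreenbergVatsal2000 Literature.NumberTheory.GaloisRepresentations
  Literature.NumberTheory.EllipticCurves.FineSelmerCoefficientMap
  Literature.NumberTheory.EllipticCurves.Castella2018
  Summit.BirchSwinnertonDyer.BirchSwinnertonDyer.Theorems.UniversalToricDescentResidualSelmer
  Summit.BirchSwinnertonDyer.BirchSwinnertonDyer.Theorems.CharResidualSelmerCount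
  Summit.BirchSwinnertonDyer.BirchSwinnertonDyer.Theorems.ResidualDevissageCount
  Summit.BirchSwinnertonDyer.BirchSwinnertonDyer.Theorems.CumulativeHeegnerInclusionAtThreeStubB1Devissage
  Summit.BirchSwinnertonDyer.BirchSwinnertonDyer.Theorems.ResidualIndexUnramified
  Summit.BirchSwinnertonDyer.BirchSwinnertonDyer.Theorems.ResidualIndexKummer
  Summit.BirchSwinnertonDyer.BirchSwinnertonDyer.Theorems.FiniteIndexCalculus

variable {K : Type} [Field K] [NumberField K]

/-! ## §1 Small tools -/

section Tools

variable (H : Subgroup (absoluteGaloisGroup K)) [H.Normal] {p : ℕ} (S₀ : Set (HeightOneSpectrum (𝓞 K)))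
  (𝔭 : HeightOneSpectrum (𝓞 K))
variable {M : Type} [AddCommGroup M] [DistribMulAction (absoluteGaloisGroup K) M] [TopologicalSpace M]
  [DiscreteTopology M]

/-- With representatives `τ i` controlling the strict condition at every place above `𝔭` (`hreps`), a class unramified
outside `S₀ ∪ {p}` lies in `R_𝔭^{S₀} = datumStrictSelmer H M p (bdpData M p 𝔭) S₀` iff it dies on `H ⊓ D_𝔭` after conjugation
by each `τ i`. [cite: Castella2018, Def. 2.2 (arXiv:1704.06608 p. 5)] [cite: GreenbergLNM1716, §3] -/
theorem mem_datumStrictSelmer_iff_of_reps [Fact p.Prime] (h𝔭 : ((p : ℕ) : 𝓞 K) ∈ 𝔭.asIdeal) (c : ℕ)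
    (τ : ℕ → absoluteGaloisGroup K)
    (hreps : ∀ x : subgroupH1 H M,
      (∀ i, i < p ^ c → resOfLe M (inf_le_left : H ⊓ decomp 𝔭 ≤ H) (conjH1 H M (τ i) x) = 0) →
        ∀ σ : absoluteGaloisGroup K, resOfLe M (inf_le_left : H ⊓ decomp 𝔭 ≤ H) (conjH1 H M σ x) = 0)
    {x : subgroupH1 H M} (hx : x ∈ unramifiedOutside H M p S₀) :
    x ∈ datumStrictSelmer H M p (AcSelmer.bdpData M p 𝔭) S₀ ↔
      ∀ i : Fin (p ^ c), resOfLe M (inf_le_left : H ⊓ decomp 𝔭 ≤ H) (conjH1 H M (τ i) x) = 0 := by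
  rw [mem_datumStrictSelmer_iff]
  constructor
  · intro h i
    have h' := h.2 𝔭 h𝔭 (τ i)
    rw [AcSelmer.bdpData_self p 𝔭 h𝔭, mem_strictKer_strictDatum_iff_resOfLe] at h'
    exact h'
  · intro h
    refine ⟨hx, fun v hv σ ↦ ?_⟩
    by_cases hv𝔭 : v = 𝔭
    · subst hv𝔭
      rw [AcSelmer.bdpData_self p v hv, mem_strictKer_strictDatum_iff_resOfLe]
      exact hreps x (fun i hi ↦ h ⟨i, hi⟩) σ
    · rw [AcSelmer.bdpData_of_ne p 𝔭 hv hv𝔭, AcSelmer.strictKer_relaxedDatum_eq_top]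
      exact AddSubgroup.mem_top _

/-- `H¹(G, N)` classes of a module with `j : N ↪ A` onto `A[p]` are `p`-torsion. [cite: SerreGaloisCohomology1997, I §2.2] -/
theorem nsmul_eq_zero_of_kummer {G : Type} [Group G] [TopologicalSpace G] [IsTopologicalGroup G]
    {N A : Type} [AddCommGroup N] [DistribMulAction G N] [TopologicalSpace N] [DiscreteTopology N]
    [AddCommGroup A] (j : N →+ A) (hinj : Injective j) (hrange : ∀ x : A, x ∈ j.range ↔ p • x = 0)
    (x : discreteH1 G N) : p • x = 0 :=
  nsmul_discreteH1_eq_zero (fun n ↦ hinj (by rw [map_nsmul, map_zero]; exact (hrange _).1 ⟨n, rfl⟩)) x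

/-- `#ker(f ∘ — : (Fin n → α) → (Fin n → β)) = (#ker f)^n`. [folklore] -/
theorem natCard_ker_compLeft {α β : Type*} [AddCommGroup α] [AddCommGroup β] (f : α →+ β) (n : ℕ) :
    Nat.card (f.compLeft (Fin n)).ker = Nat.card f.ker ^ n := by
  have e : (f.compLeft (Fin n)).ker ≃ (Fin n → f.ker) :=
    { toFun := fun y i ↦ ⟨y.1 i, by
        have h := (AddMonoidHom.mem_ker).1 y.2
        exact congrFun h i⟩
      invFun := fun z ↦ ⟨fun i ↦ (z i : α), by
        rw [AddMonoidHom.mem_ker]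
        funext i
        exact (AddMonoidHom.mem_ker).1 (z i).2⟩
      left_inv := fun _ ↦ rfl
      right_inv := fun _ ↦ rfl }
  rw [Nat.card_congr e, Nat.card_pi, Finset.prod_const, Finset.card_univ, Fintype.card_fin]

end Tools

/-! ## §2 One module: the package `(loc, κ, κ')` with its properties -/

section Module

variable (H : Subgroup (absoluteGaloisGroup K)) [H.Normal] (p : ℕ) [Fact p.Prime]
  (S₀ : Set (HeightOneSpectrum (𝓞 K))) (𝔭 : HeightOneSpectrum (𝓞 K))
variable {N : Type} [AddCommGroup N] [DistribMulAction (absoluteGaloisGroup K) N] [TopologicalSpace N]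
  [DiscreteTopology N]
variable {A : Type} [AddCommGroup A] [DistribMulAction (absoluteGaloisGroup K) A] [TopologicalSpace A]
  [DiscreteTopology A]

/-- **The index data of ONE module** (road steps (1)–(2), packaged for `FiniteIndexCalculus.zpCorank_add_eq_of_index_inputs`):
from the Kummer embedding `j : N ↪ A` onto `A[p]` (`A` divisible), representatives `τ i` of the places above `𝔭`, (U) for `j`,
SUR, DIV, COT for `R(A) = datumStrictSelmer H A p (bdpData A p 𝔭) S₀` and `A^H` divisible in invariants: the signature map
`loc : U(A) → ∏_{i<p^c} H¹(H ⊓ D_𝔭, A)` (onto, divisible target, kernel ≅ `R(A)`), the Kummer surjection `κ : U(N) ↠ U(A)[p]`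
(injective) and the local one `κ'`, with their defining formulas. [cite: KellerYin2024, Lemma 1.2.4 and §1.4 (arXiv:2402.12781v2)]
[cite: GreenbergVatsal2000, §2 pp. 16–17] -/
theorem exists_module_index_data (h𝔭 : ((p : ℕ) : 𝓞 K) ∈ 𝔭.asIdeal) (j : N →+ A)
    (hj : ∀ (g : absoluteGaloisGroup K) (a : N), j (g • a) = g • j a) (hjinj : Injective j)
    (hr : ∀ x : A, x ∈ j.range ↔ p • x = 0) (hd : ∀ x : A, ∃ x' : A, p • x' = x)
    (hcA : ∀ a : A, Continuous fun g : absoluteGaloisGroup K ↦ g • a)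
    (hU : ∀ v : HeightOneSpectrum (𝓞 K), v ∉ S₀ → ((p : ℕ) : 𝓞 K) ∉ v.asIdeal →
      Injective (resH1Hom (ContinuousMonoidHom.id (inertiaIn H v)) j
        (fun g m ↦ hj ((g : decomp (K := K) v) : absoluteGaloisGroup K) m)))
    (c : ℕ) (τ : ℕ → absoluteGaloisGroup K)
    (hreps : ∀ x : subgroupH1 H A,
      (∀ i, i < p ^ c → resOfLe A (inf_le_left : H ⊓ decomp 𝔭 ≤ H) (conjH1 H A (τ i) x) = 0) →
        ∀ σ : absoluteGaloisGroup K, resOfLe A (inf_le_left : H ⊓ decomp 𝔭 ≤ H) (conjH1 H A σ x) = 0)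
    (hsur : ∀ y : Fin (p ^ c) → subgroupH1 (H ⊓ decomp 𝔭) A, ∃ u ∈ unramifiedOutside H A p S₀,
      ∀ i : Fin (p ^ c), resOfLe A (inf_le_left : H ⊓ decomp 𝔭 ≤ H) (conjH1 H A (τ i) u) = y i)
    (hdiv : ∀ y : subgroupH1 (H ⊓ decomp 𝔭) A, ∃ y', p • y' = y)
    (hprim : ∀ s : datumStrictSelmer H A p (AcSelmer.bdpData A p 𝔭) S₀, ∃ n : ℕ, p ^ n • s = 0)
    [Finite (AddSubgroup.torsionBy (datumStrictSelmer H A p (AcSelmer.bdpData A p 𝔭) S₀) (p : ℤ))]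
    (hinv : ∀ x : A, (∀ g : H, g • x = x) → ∃ x' : A, (∀ g : H, g • x' = x') ∧ p • x' = x) :
    ∃ (loc : unramifiedOutside H A p S₀ →+ (Fin (p ^ c) → subgroupH1 (H ⊓ decomp 𝔭) A))
      (κ : unramifiedOutside H N p S₀ →+ AddSubgroup.torsionBy (unramifiedOutside H A p S₀) (p : ℤ))
      (κ' : (Fin (p ^ c) → subgroupH1 (H ⊓ decomp 𝔭) N) →+
        AddSubgroup.torsionBy (Fin (p ^ c) → subgroupH1 (H ⊓ decomp 𝔭) A) (p : ℤ)),
      (∀ (u : unramifiedOutside H A p S₀) (i : Fin (p ^ c)),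
          loc u i = resOfLe A (inf_le_left : H ⊓ decomp 𝔭 ≤ H) (conjH1 H A (τ i) u)) ∧
      (∀ x : unramifiedOutside H N p S₀,
          (((κ x : AddSubgroup.torsionBy (unramifiedOutside H A p S₀) (p : ℤ)) : unramifiedOutside H A p S₀) :
              subgroupH1 H A) =
            resH1Hom (ContinuousMonoidHom.id H) j (fun g a ↦ hj (g : absoluteGaloisGroup K) a) x) ∧
      (∀ (y : Fin (p ^ c) → subgroupH1 (H ⊓ decomp 𝔭) N) (i : Fin (p ^ c)),
          ((κ' y : AddSubgroup.torsionBy (Fin (p ^ c) → subgroupH1 (H ⊓ decomp 𝔭) A) (p : ℤ)) :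
              Fin (p ^ c) → subgroupH1 (H ⊓ decomp 𝔭) A) i =
            resH1Hom (ContinuousMonoidHom.id ↥(H ⊓ decomp 𝔭)) j (fun g a ↦ hj (g : absoluteGaloisGroup K) a) (y i)) ∧
      Surjective loc ∧ (∀ y : Fin (p ^ c) → subgroupH1 (H ⊓ decomp 𝔭) A, ∃ y', p • y' = y) ∧
      (∀ s : loc.ker, ∃ n : ℕ, p ^ n • s = 0) ∧ Finite (AddSubgroup.torsionBy loc.ker (p : ℤ)) ∧
      Surjective κ ∧ Surjective κ' ∧ Injective κ ∧
      Nat.card κ'.ker = Nat.card (resH1Hom (ContinuousMonoidHom.id ↥(H ⊓ decomp 𝔭)) j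
        (fun g a ↦ hj (g : absoluteGaloisGroup K) a)).ker ^ p ^ c ∧
      zpCorank loc.ker p = zpCorank (datumStrictSelmer H A p (AcSelmer.bdpData A p 𝔭) S₀) p := by
  have hcAH : ∀ a : A, Continuous fun g : H ↦ g • a := fun a ↦ (hcA a).comp continuous_subtype_val
  have hcAD : ∀ a : A, Continuous fun g : ↥(H ⊓ decomp 𝔭) ↦ g • a := fun a ↦
    (hcA a).comp continuous_subtype_val
  -- the signature map
  let Ψ : subgroupH1 H A →+ (Fin (p ^ c) → subgroupH1 (H ⊓ decomp 𝔭) A) :=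
    AddMonoidHom.pi fun k ↦ (resOfLe A (inf_le_left : H ⊓ decomp 𝔭 ≤ H)).comp (conjH1 H A (τ k))
  let loc := Ψ.comp (unramifiedOutside H A p S₀).subtype
  have hlocf : ∀ (u : unramifiedOutside H A p S₀) (i : Fin (p ^ c)),
      loc u i = resOfLe A (inf_le_left : H ⊓ decomp 𝔭 ≤ H) (conjH1 H A (τ i) u) := fun _ _ ↦ rfl
  -- the Kummer maps
  let jH := resH1Hom (ContinuousMonoidHom.id H) j (fun g a ↦ hj (g : absoluteGaloisGroup K) a)
  let jD := resH1Hom (ContinuousMonoidHom.id ↥(H ⊓ decomp 𝔭)) j (fun g a ↦ hj (g : absoluteGaloisGroup K) a)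
  have hjU : ∀ x : unramifiedOutside H N p S₀, (jH.comp (unramifiedOutside H N p S₀).subtype) x ∈
      unramifiedOutside H A p S₀ := fun x ↦ resH1Hom_mem_unramifiedOutside H p S₀ j hj x.2
  have htN : ∀ x : subgroupH1 H N, p • x = 0 := nsmul_eq_zero_of_kummer j hjinj hr
  have htND : ∀ x : subgroupH1 (H ⊓ decomp 𝔭) N, p • x = 0 := nsmul_eq_zero_of_kummer j hjinj hr
  have hpt : ∀ x : unramifiedOutside H N p S₀,
      ((jH.comp (unramifiedOutside H N p S₀).subtype).codRestrict (unramifiedOutside H A p S₀) hjU) x ∈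
        AddSubgroup.torsionBy (unramifiedOutside H A p S₀) (p : ℤ) := fun x ↦
    AddSubgroup.torsionBy.nsmul_iff.mpr (Subtype.ext (by
      change p • jH (x : subgroupH1 H N) = 0
      rw [← map_nsmul, htN, map_zero]))
  let κ := ((jH.comp (unramifiedOutside H N p S₀).subtype).codRestrict (unramifiedOutside H A p S₀) hjU).codRestrict
    (AddSubgroup.torsionBy (unramifiedOutside H A p S₀) (p : ℤ)) hpt
  have hκf : ∀ x : unramifiedOutside H N p S₀,
      (((κ x : AddSubgroup.torsionBy (unramifiedOutside H A p S₀) (p : ℤ)) : unramifiedOutside H A p S₀) :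
        subgroupH1 H A) = jH x := fun _ ↦ rfl
  have hpt' : ∀ y : Fin (p ^ c) → subgroupH1 (H ⊓ decomp 𝔭) N,
      (jD.compLeft (Fin (p ^ c))) y ∈ AddSubgroup.torsionBy (Fin (p ^ c) → subgroupH1 (H ⊓ decomp 𝔭) A) (p : ℤ) :=
    fun y ↦ AddSubgroup.torsionBy.nsmul_iff.mpr (funext fun k ↦ by
      rw [Pi.smul_apply, Pi.zero_apply, AddMonoidHom.compLeft_apply, Function.comp_apply, ← map_nsmul, htND,
        map_zero])
  let κ' := (jD.compLeft (Fin (p ^ c))).codRestrict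
    (AddSubgroup.torsionBy (Fin (p ^ c) → subgroupH1 (H ⊓ decomp 𝔭) A) (p : ℤ)) hpt'
  have hκ'f : ∀ (y : Fin (p ^ c) → subgroupH1 (H ⊓ decomp 𝔭) N) (i : Fin (p ^ c)),
      ((κ' y : AddSubgroup.torsionBy (Fin (p ^ c) → subgroupH1 (H ⊓ decomp 𝔭) A) (p : ℤ)) :
        Fin (p ^ c) → subgroupH1 (H ⊓ decomp 𝔭) A) i = jD (y i) := fun _ _ ↦ rfl
  refine ⟨loc, κ, κ', hlocf, hκf, hκ'f, ?_, ?_, ?_, ?_, ?_, ?_, ?_, ?_, ?_⟩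
  · -- SUR
    intro y
    obtain ⟨u, hu, huy⟩ := hsur y
    exact ⟨⟨u, hu⟩, funext fun k ↦ huy k⟩
  · -- DIV
    intro y
    choose f hf using fun k ↦ hdiv (y k)
    exact ⟨f, funext fun k ↦ by rw [Pi.smul_apply, hf]⟩
  · -- COT: `p`-primary, through `ker loc ≅ R(A)`
    intro s
    have hs : ((s : unramifiedOutside H A p S₀) : subgroupH1 H A) ∈ datumStrictSelmer H A p (AcSelmer.bdpData A p 𝔭) S₀ := by
      rw [mem_datumStrictSelmer_iff_of_reps H S₀ 𝔭 h𝔭 c τ hreps (s : unramifiedOutside H A p S₀).2]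
      intro k
      exact congrFun ((AddMonoidHom.mem_ker).1 s.2) k
    obtain ⟨n, hn⟩ := hprim ⟨_, hs⟩
    refine ⟨n, Subtype.ext (Subtype.ext ?_)⟩
    have h := congrArg Subtype.val hn
    rw [AddSubgroupClass.coe_nsmul] at h
    rw [AddSubgroupClass.coe_nsmul, AddSubgroupClass.coe_nsmul]
    exact h
  · -- COT: finite `p`-torsion, through the same identification
    refine Finite.of_injective (fun x : AddSubgroup.torsionBy loc.ker (p : ℤ) ↦
      (⟨⟨((x.1 : loc.ker) : unramifiedOutside H A p S₀), ?_⟩, ?_⟩ :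
        AddSubgroup.torsionBy (datumStrictSelmer H A p (AcSelmer.bdpData A p 𝔭) S₀) (p : ℤ))) ?_
    · rw [mem_datumStrictSelmer_iff_of_reps H S₀ 𝔭 h𝔭 c τ hreps ((x.1 : loc.ker) : unramifiedOutside H A p S₀).2]
      intro k
      exact congrFun ((AddMonoidHom.mem_ker).1 (x.1 : loc.ker).2) k
    · refine AddSubgroup.torsionBy.nsmul_iff.mpr (Subtype.ext ?_)
      have h := congrArg (fun z : loc.ker ↦ ((z : unramifiedOutside H A p S₀) : subgroupH1 H A))
        (AddSubgroup.torsionBy.nsmul_iff.mp x.2)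
      simp only [AddSubgroupClass.coe_nsmul, ZeroMemClass.coe_zero] at h
      rw [AddSubgroupClass.coe_nsmul]
      exact h
    · intro x y hxy
      simp only [Subtype.mk.injEq] at hxy
      exact Subtype.ext (Subtype.ext (Subtype.ext hxy))
  · -- Kummer onto `U(A)[p]`
    intro u
    have hpu : p • ((u : unramifiedOutside H A p S₀) : subgroupH1 H A) = 0 := by
      have h := congrArg (fun z : unramifiedOutside H A p S₀ ↦ (z : subgroupH1 H A))
        (AddSubgroup.torsionBy.nsmul_iff.mp u.2)
      simpa only [AddSubgroupClass.coe_nsmul, ZeroMemClass.coe_zero] using h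
    obtain ⟨x, hx, hxu⟩ := exists_mem_unramifiedOutside_resH1Hom_eq_of_nsmul_eq_zero H p S₀ j hj hjinj hr hd hcA hU
      (u : unramifiedOutside H A p S₀).2 hpu
    exact ⟨⟨x, hx⟩, Subtype.ext (Subtype.ext hxu)⟩
  · -- local Kummer onto
    intro y
    have hy : ∀ k, p • (y : Fin (p ^ c) → subgroupH1 (H ⊓ decomp 𝔭) A) k = 0 := fun k ↦ by
      have h := AddSubgroup.torsionBy.nsmul_iff.mp y.2
      exact (congrFun h k : (p • (y : Fin (p ^ c) → subgroupH1 (H ⊓ decomp 𝔭) A)) k = 0)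
    choose x hx using fun k ↦ exists_resH1Hom_id_eq_of_nsmul_eq_zero (G := ↥(H ⊓ decomp 𝔭)) j
      (fun g a ↦ hj (g : absoluteGaloisGroup K) a) hjinj hr hcAD hd _ (hy k)
    exact ⟨x, Subtype.ext (funext fun k ↦ hx k)⟩
  · -- `κ` injective (`A^H` divisible in invariants)
    intro x y h
    have h' : jH x = jH y := by rw [← hκf, ← hκf, h]
    exact Subtype.ext (resH1Hom_id_injective_of_invariants_divisible (G := H) j _ hjinj hr hinv h')
  · -- `#ker κ' = (#ker j_*^D)^{p^c}`
    have h : κ'.ker = (jD.compLeft (Fin (p ^ c))).ker := AddMonoidHom.ker_codRestrict _ _ _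
    rw [h]
    exact natCard_ker_compLeft jD (p ^ c)
  · -- `zpCorank (ker loc) = zpCorank R(A)`
    have hker : ∀ u : unramifiedOutside H A p S₀,
        u ∈ loc.ker ↔ (u : subgroupH1 H A) ∈ datumStrictSelmer H A p (AcSelmer.bdpData A p 𝔭) S₀ := by
      intro u
      rw [mem_datumStrictSelmer_iff_of_reps H S₀ 𝔭 h𝔭 c τ hreps u.2, AddMonoidHom.mem_ker]
      exact ⟨fun h k ↦ congrFun h k, fun h ↦ funext fun k ↦ h k⟩
    let e : loc.ker ≃+ datumStrictSelmer H A p (AcSelmer.bdpData A p 𝔭) S₀ :=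
      { toFun := fun s ↦ ⟨(s.1 : subgroupH1 H A), (hker s.1).1 s.2⟩
        invFun := fun t ↦ ⟨⟨t.1, ((mem_datumStrictSelmer_iff _).1 t.2).1⟩, (hker _).2 t.2⟩
        left_inv := fun _ ↦ rfl
        right_inv := fun _ ↦ rfl
        map_add' := fun _ _ ↦ rfl }
    exact zpCorank_congr e p

end Module

/-! ## §3 The residual rows on the unramified classes -/

section Rows

variable (H : Subgroup (absoluteGaloisGroup K)) [H.Normal] (p : ℕ) [Fact p.Prime]
  (S₀ : Set (HeightOneSpectrum (𝓞 K)))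
variable {N₁ : Type} [AddCommGroup N₁] [DistribMulAction (absoluteGaloisGroup K) N₁] [TopologicalSpace N₁]
  [DiscreteTopology N₁]
variable {N₂ : Type} [AddCommGroup N₂] [DistribMulAction (absoluteGaloisGroup K) N₂] [TopologicalSpace N₂]
  [DiscreteTopology N₂]
variable {N₃ : Type} [AddCommGroup N₃] [DistribMulAction (absoluteGaloisGroup K) N₃] [TopologicalSpace N₃]
  [DiscreteTopology N₃]

omit [Fact p.Prime] in
/-- **The residual row `U(N₁) →a U(N₂) →b U(N₃)`** (restrictions of `i_*`, `π_*`): exact in the middle, with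
`#ker a = #N₃^H` when `N₂^H = 0`, and `im b = π_*(U(N₂))`. [cite: SerreGaloisCohomology1997, I §2.2] -/
theorem exists_rows_data (i : N₁ →+ N₂) (π : N₂ →+ N₃)
    (hi : ∀ (g : absoluteGaloisGroup K) (a : N₁), i (g • a) = g • i a)
    (hπ : ∀ (g : absoluteGaloisGroup K) (b : N₂), π (g • b) = g • π b)
    (hiinj : Injective i) (hπsurj : Surjective π) (hexact : ∀ b : N₂, π b = 0 → ∃ a : N₁, i a = b)
    (hπi : ∀ a : N₁, π (i a) = 0)
    (hcN₁ : ∀ a : N₁, Continuous fun g : absoluteGaloisGroup K ↦ g • a)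
    (hcN₂ : ∀ a : N₂, Continuous fun g : absoluteGaloisGroup K ↦ g • a)
    (hcN₃ : ∀ a : N₃, Continuous fun g : absoluteGaloisGroup K ↦ g • a)
    (hUi : ∀ v : HeightOneSpectrum (𝓞 K), v ∉ S₀ → ((p : ℕ) : 𝓞 K) ∉ v.asIdeal →
      Injective (resH1Hom (ContinuousMonoidHom.id (inertiaIn H v)) i
        (fun g m ↦ hi ((g : decomp (K := K) v) : absoluteGaloisGroup K) m)))
    (hN₂ : ∀ n : N₂, (∀ g : H, g • n = n) → n = 0) [Finite {n : N₃ // ∀ g : H, g • n = n}] :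
    ∃ (a : unramifiedOutside H N₁ p S₀ →+ unramifiedOutside H N₂ p S₀)
      (b : unramifiedOutside H N₂ p S₀ →+ unramifiedOutside H N₃ p S₀),
      (∀ x, ((a x : unramifiedOutside H N₂ p S₀) : subgroupH1 H N₂) =
        resH1Hom (ContinuousMonoidHom.id H) i (fun g m ↦ hi (g : absoluteGaloisGroup K) m) x) ∧
      (∀ y, ((b y : unramifiedOutside H N₃ p S₀) : subgroupH1 H N₃) =
        resH1Hom (ContinuousMonoidHom.id H) π (fun g m ↦ hπ (g : absoluteGaloisGroup K) m) y) ∧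
      Exact a b ∧ Nat.card a.ker = Nat.card {n : N₃ // ∀ g : H, g • n = n} ∧
      b.range = ((unramifiedOutside H N₂ p S₀).map (resH1Hom (ContinuousMonoidHom.id H) π
          (fun g m ↦ hπ (g : absoluteGaloisGroup K) m))).addSubgroupOf (unramifiedOutside H N₃ p S₀) := by
  have hcN₁H : ∀ a : N₁, Continuous fun g : H ↦ g • a := fun a ↦ (hcN₁ a).comp continuous_subtype_val
  have hcN₂H : ∀ a : N₂, Continuous fun g : H ↦ g • a := fun a ↦ (hcN₂ a).comp continuous_subtype_val
  have hcN₃H : ∀ a : N₃, Continuous fun g : H ↦ g • a := fun a ↦ (hcN₃ a).comp continuous_subtype_val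
  have hexπ : ∀ b : N₂, π b = 0 ↔ b ∈ i.range := fun b ↦
    ⟨fun h ↦ by obtain ⟨a, ha⟩ := hexact b h; exact ⟨a, ha⟩, by rintro ⟨a, rfl⟩; exact hπi a⟩
  let iH := resH1Hom (ContinuousMonoidHom.id H) i (fun g a ↦ hi (g : absoluteGaloisGroup K) a)
  let πH := resH1Hom (ContinuousMonoidHom.id H) π (fun g b ↦ hπ (g : absoluteGaloisGroup K) b)
  have hiX : ∀ x : unramifiedOutside H N₁ p S₀, (iH.comp (unramifiedOutside H N₁ p S₀).subtype) x ∈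
      unramifiedOutside H N₂ p S₀ := fun x ↦ resH1Hom_mem_unramifiedOutside H p S₀ i hi x.2
  have hπX : ∀ x : unramifiedOutside H N₂ p S₀, (πH.comp (unramifiedOutside H N₂ p S₀).subtype) x ∈
      unramifiedOutside H N₃ p S₀ := fun x ↦ resH1Hom_mem_unramifiedOutside H p S₀ π hπ x.2
  let a := (iH.comp (unramifiedOutside H N₁ p S₀).subtype).codRestrict (unramifiedOutside H N₂ p S₀) hiX
  let b := (πH.comp (unramifiedOutside H N₂ p S₀).subtype).codRestrict (unramifiedOutside H N₃ p S₀) hπX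
  refine ⟨a, b, fun _ ↦ rfl, fun _ ↦ rfl, ?_, ?_, ?_⟩
  · intro y
    constructor
    · intro hy
      have hy' : πH (y : subgroupH1 H N₂) = 0 := Subtype.ext_iff.mp hy
      obtain ⟨x, hx, hxy⟩ := exists_mem_unramifiedOutside_resH1Hom_eq_of_resH1Hom_eq_zero H p S₀ i π hi hiinj
        hπ hπsurj hexact hcN₂ hUi y.2 hy'
      exact ⟨⟨x, hx⟩, Subtype.ext hxy⟩
    · rintro ⟨x, rfl⟩
      exact Subtype.ext (resH1Hom_id_comp_eq_zero (G := H) i _ π _ hπi (x : subgroupH1 H N₁))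
  · have hle : iH.ker ≤ unramifiedOutside H N₁ p S₀ := ker_resH1Hom_le_unramifiedOutside H p S₀ i hi hUi
    have e : a.ker ≃ iH.ker :=
      { toFun := fun x ↦ ⟨(x.1 : subgroupH1 H N₁), (AddMonoidHom.mem_ker).2 (Subtype.ext_iff.mp
          ((AddMonoidHom.mem_ker).1 x.2))⟩
        invFun := fun y ↦ ⟨⟨y.1, hle y.2⟩, (AddMonoidHom.mem_ker).2 (Subtype.ext ((AddMonoidHom.mem_ker).1 y.2))⟩
        left_inv := fun _ ↦ rfl
        right_inv := fun _ ↦ rfl }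
    rw [Nat.card_congr e]
    exact natCard_ker_resH1Hom_eq_of_noFixed (G := H) i π _ (fun g b ↦ hπ (g : absoluteGaloisGroup K) b) hiinj
      hexπ hπsurj hcN₁H hcN₂H hcN₃H hN₂
  · ext y
    rw [AddSubgroup.mem_addSubgroupOf, AddSubgroup.mem_map]
    constructor
    · rintro ⟨x, rfl⟩
      exact ⟨(x : subgroupH1 H N₂), x.2, rfl⟩
    · rintro ⟨x, hx, hxy⟩
      exact ⟨⟨x, hx⟩, Subtype.ext hxy⟩

end Rows

end Summit.BirchSwinnertonDyer.BirchSwinnertonDyer.Theorems.ResidualIndexModuleData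

end
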